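import Literature.NumberTheory.LFunctions.KloostermanPrimePower
import Mathlib.NumberTheory.DirichletCharacter.GaussSum
import Mathlib.NumberTheory.DirichletCharacter.Bounds
import Mathlib.Analysis.Fourier.ZMod
import Mathlib.GroupTheory.FiniteAbelian.Duality
import Mathlib.NumberTheory.MulChar.Duality
import Mathlib.RingTheory.RootsOfUnity.AlgebraicallyClosed
import Mathlib.FieldTheory.IsAlgClosed.Basic
import Mathlib.Analysis.Complex.Polynomial.Basic
import Mathlib.NumberTheory.Basic
import HarnessLib

/-!
# The wild characters of conductor `p^m`: orthogonality, support, and Gauss-sum averages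

Topic `NumberTheory/EllipticCurves` (the character family of the `p`-adic `L`-function,
Mazur–Tate–Teitelbaum 1986, §I.13–I.14; companion of `PAdicLFunctionInterpolationProofs`).
Fix a prime `p` and `m ≥ 1`. The **wild characters of conductor `p^m`** are the primitive,
even Dirichlet characters mod `p^m` of `p`-power order (`wildChars p m`, a `Finset`) — exactly
the characters of `(ℤ/p^mℤ)ˣ` which are characters of `Γ = ℤ_p^×/torsion` and have conductor
`p^m`, i.e. (up to the embeddings `ℚ̄ → ℂ`, `ℚ̄ → ℂ_p` of `PAdicLFunctionProofs`) the
characters `χ` at which `L_p(E, T)` interpolates `L(E, χ̄, 1)` (`IsPAdicLFunctionOf`, stated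
for `ℂ_p`-valued characters). This file proves the finite harmonic analysis of this family needed for
the first moment of `L(f ⊗ χ, 1)` over it (`PAdicLFunctionMomentProofs`):

* `even_and_ppow_iff_trivial_on_teichmuller`, `isPrimitive_iff_exists_reductionKer`,
  `mem_wildChars_iff`: `χ ∈ 𝔛_m` iff `χ` is trivial on `T = {x : x^{p-1} = ±1}` and
  non-trivial on `K = ker (mod p^{m-1})`.
* `sum_wildChars_apply_eq_zero` (**orthogonality**): `∑_{χ ∈ 𝔛_m} χ(u) = 0` unless
  `u ∈ H = T·K`, by duality for `(ℤ/p^m)ˣ / H` (Mathlib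
  `CommGroup.exists_apply_ne_one_of_hasEnoughRootsOfUnity`); hence the support of
  `n ↦ ∑_χ χ(n)` is contained in `{n : n^{2(p-1)} ≡ 1 (mod p^{m-1})}`
  (`pow_eq_one_of_sum_wildChars_ne_zero`), a union of at most `4p` classes
  (`card_filter_pow_eq_one_le`, a Hensel-type count) — at most `4p²` residues mod `p^m`
  (`card_support_sum_wildChars_le`).
* `sum_wildChars_mul_gaussSum_sq_eq`, `norm_sum_wildChars_mul_gaussSum_sq_le` (**the family
  average of the root numbers**): for a unit `y`,
  `∑_{χ ∈ 𝔛_m} χ(y) τ(χ)² = ∑_{h ∈ supp} (∑_χ χ(h)) · S(1, h y⁻¹; p^m)` is a short sum of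
  Kloosterman sums, so `‖·‖ ≤ 4p² · #𝔛_m · 4 p^{⌈m/2⌉}` by the elementary Kloosterman bound
  `norm_kloostermanSum_one_le` — square-root cancellation in the conductor. In Rohrlich 1984,
  §3–4, the corresponding step (for the Galois average) is done with explicit Gauss sums.

(`τ(χ) τ(χ̄) = χ(-1) p^m` for primitive `χ`, needed by the consumer, is the existing
`Literature.NumberTheory.Sieve.LargeSieve.gaussSum_mul_gaussSum_inv` of `Sieve/LargeSieveCharacters`.)

## References

* B. Mazur, J. Tate, J. Teitelbaum, *On `p`-adic analogues of the conjectures of Birch and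
  Swinnerton-Dyer*, Invent. Math. 84 (1986), §I.13–I.14.
* D. E. Rohrlich, *On `L`-functions of elliptic curves and cyclotomic towers*, Invent. Math. 75
  (1984), 409–423, §3–4.
* L. C. Washington, *Introduction to cyclotomic fields*, GTM 83, §7.2.
* T. M. Apostol, *Introduction to analytic number theory*, Thm. 8.15 (`|τ(χ)|² = N`).
-/

noncomputable section

open scoped BigOperators
open Finset

namespace Literature.NumberTheory.EllipticCurves

variable {p : ℕ} [hp : Fact p.Prime]

/-! ### The subgroups `T = {x^{p-1} = ±1}`, `K = ker (mod p^{m-1})`, `H = T K` of `(ℤ/p^m)ˣ` -/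

namespace WildChars

/-- The **Teichmüller-type subgroup** `T = {x : x^{p-1} = ±1}` of `(ℤ/p^mℤ)ˣ`: for odd `p` this is
`μ_{p-1}` (the torsion of `ℤ_p^×` mod `p^m`), for `p = 2` it is `{±1}`; in both cases it is the
image of the torsion subgroup of `ℤ_p^×`, and the characters of `(ℤ/p^mℤ)ˣ/T` are the Dirichlet
characters mod `p^m` that are characters of `Γ = ℤ_p^×/torsion` (even, of `p`-power order)
(Washington, *Cyclotomic fields*, §7.2; Mazur–Tate–Teitelbaum 1986, §I.13). [folklore] -/
def teichmullerSubgroup (p m : ℕ) : Subgroup (ZMod (p ^ m))ˣ where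
  carrier := {x | x ^ (p - 1) = 1 ∨ x ^ (p - 1) = -1}
  mul_mem' := by
    rintro x y (hx | hx) (hy | hy) <;>
      simp only [Set.mem_setOf_eq, mul_pow, hx, hy, mul_one, mul_neg, neg_neg, true_or, or_true]
  one_mem' := Or.inl (one_pow _)
  inv_mem' := by
    rintro x (hx | hx) <;>
      simp only [Set.mem_setOf_eq, inv_pow, hx, inv_one, inv_neg_one, true_or, or_true]

omit hp in
/-- Membership in `T`. [folklore] -/
theorem mem_teichmullerSubgroup {m : ℕ} (x : (ZMod (p ^ m))ˣ) :
    x ∈ teichmullerSubgroup p m ↔ x ^ (p - 1) = 1 ∨ x ^ (p - 1) = -1 :=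
  Iff.rfl

/-- The kernel `K` of reduction `(ℤ/p^mℤ)ˣ → (ℤ/p^{m-1}ℤ)ˣ` (of order `p` for `m ≥ 2`).
[folklore] -/
def reductionKer (p m : ℕ) : Subgroup (ZMod (p ^ m))ˣ :=
  (ZMod.unitsMap (pow_dvd_pow p (Nat.sub_le m 1))).ker

/-- The subgroup `H = T · K` of `(ℤ/p^mℤ)ˣ` (Teichmüller-type subgroup times the kernel of
reduction mod `p^{m-1}`): the subgroup outside which `∑_{χ ∈ 𝔛_m} χ` vanishes
(`sum_wildChars_apply_eq_zero`). [folklore] -/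
def teichmullerMulReductionKer (p m : ℕ) : Subgroup (ZMod (p ^ m))ˣ :=
  teichmullerSubgroup p m ⊔ reductionKer p m

omit hp in
/-- Elements of `H = T K` have `2(p-1)`-th power `≡ 1 (mod p^{m-1})`. [folklore] -/
theorem cast_pow_eq_one_of_mem_teichmullerMulReductionKer {m : ℕ} {x : (ZMod (p ^ m))ˣ}
    (hx : x ∈ teichmullerMulReductionKer p m) :
    (ZMod.castHom (pow_dvd_pow p (Nat.sub_le m 1)) (ZMod (p ^ (m - 1))) (x : ZMod (p ^ m))) ^
      (2 * (p - 1)) = 1 := by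
  rw [teichmullerMulReductionKer, Subgroup.mem_sup] at hx
  obtain ⟨t, ht, k, hk, rfl⟩ := hx
  have ht2 : t ^ (2 * (p - 1)) = 1 := by
    rw [mul_comm, pow_mul]
    rcases ht with h | h <;> simp [h]
  have hk' : ZMod.unitsMap (pow_dvd_pow p (Nat.sub_le m 1)) k = 1 := hk
  rw [ZMod.unitsMap_def, Units.ext_iff, Units.coe_map, Units.val_one] at hk'
  rw [Units.val_mul, map_mul, mul_pow]
  rw [MonoidHom.coe_coe] at hk'
  rw [hk', one_pow, mul_one, ← map_pow, ← Units.val_pow_eq_pow_val, ht2, Units.val_one, map_one]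

end WildChars

open WildChars

/-! ### The family `𝔛_m` of primitive even characters of `p`-power order mod `p^m` -/

/-- The **wild characters of conductor `p^m`** (`m ≥ 1`): the primitive, even Dirichlet
characters mod `p^m` of `p`-power order, with values in `ℂ`, i.e. the primitive characters of
`(ℤ/p^mℤ)ˣ` that are characters of `Γ = ℤ_p^× / torsion ≅ ℤ_p`. Up to the choice of
embeddings `ℚ̄ → ℂ`, `ℚ̄ → ℂ_p` (the transport of `PAdicLFunctionProofs`, Step 3; the defining
predicate "primitive, even, of `p`-power order" is the one of `IsPAdicLFunctionOf`, which
quantifies over `ℂ_p`-valued characters) these are the characters at which the `p`-adic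
`L`-function `L_p(E, T)` interpolates `L(E, χ̄, 1)` (Mazur–Tate–Teitelbaum 1986, §I.13–I.14).
The definition is total in `m`; for `m = 0` it is the junk value `{1}` (every theorem below
that needs it assumes `m ≠ 0`). [cite: MazurTateTeitelbaum1986Invent, §I.13–I.14] -/
def wildChars (p m : ℕ) [NeZero (p ^ m)] : Finset (DirichletCharacter ℂ (p ^ m)) := by
  classical
  haveI := Fintype.ofFinite (DirichletCharacter ℂ (p ^ m))
  exact Finset.univ.filter fun χ ↦ χ.IsPrimitive ∧ χ.Even ∧ ∃ j : ℕ, orderOf χ = p ^ j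

omit hp in
/-- Membership in `𝔛_m`: primitive, even, of `p`-power order. [folklore] -/
theorem mem_wildChars {m : ℕ} [NeZero (p ^ m)] (χ : DirichletCharacter ℂ (p ^ m)) :
    χ ∈ wildChars p m ↔ χ.IsPrimitive ∧ χ.Even ∧ ∃ j : ℕ, orderOf χ = p ^ j := by
  classical
  simp only [wildChars, Finset.mem_filter, Finset.mem_univ, true_and]

/-- `n (p - 1) = φ(n) p` for `n = p^m`, `m ≥ 1`: every unit `x` mod `p^m` has `x^{p^m} ∈ T`.
[folklore] -/
theorem pow_prime_pow_mem_teichmullerSubgroup {m : ℕ} (hm : m ≠ 0) (x : (ZMod (p ^ m))ˣ) :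
    x ^ (p ^ m) ∈ teichmullerSubgroup p m := by
  haveI : NeZero (p ^ m) := ⟨pow_ne_zero _ hp.out.ne_zero⟩
  left
  obtain ⟨k, rfl⟩ := Nat.exists_eq_succ_of_ne_zero hm
  have hnφ : p ^ (k + 1) * (p - 1) = Nat.totient (p ^ (k + 1)) * p := by
    rw [Nat.totient_prime_pow_succ hp.out]; ring
  rw [← pow_mul, hnφ, pow_mul, ZMod.pow_totient, one_pow]

/-- **Characters of `Γ`**: a Dirichlet character mod `p^m` (`m ≥ 1`) is even and of `p`-power
order iff it is trivial on `T = {x^{p-1} = ±1}`. [folklore] -/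
theorem even_and_ppow_iff_trivial_on_teichmuller {m : ℕ} (hm : m ≠ 0) (χ : DirichletCharacter ℂ (p ^ m)) :
    (χ.Even ∧ ∃ j : ℕ, orderOf χ = p ^ j) ↔ ∀ x ∈ teichmullerSubgroup p m, χ (x : ZMod (p ^ m)) = 1 := by
  haveI : NeZero (p ^ m) := ⟨pow_ne_zero _ hp.out.ne_zero⟩
  constructor
  · rintro ⟨heven, j, hj⟩ x hx
    -- `χ(x)^(p-1) = 1` and `χ(x)^(p^j) = 1`
    have h1 : χ (x : ZMod (p ^ m)) ^ (p - 1) = 1 := by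
      rw [← map_pow, ← Units.val_pow_eq_pow_val]
      rcases hx with h | h
      · rw [h, Units.val_one, map_one]
      · rw [h, Units.val_neg, Units.val_one]; exact heven
    have h2 : χ (x : ZMod (p ^ m)) ^ (p ^ j) = 1 := by
      have := congr_arg (fun ψ : DirichletCharacter ℂ (p ^ m) ↦ ψ (x : ZMod (p ^ m))) (hj ▸ pow_orderOf_eq_one χ)
      simpa only [MulChar.pow_apply_coe, MulChar.one_apply_coe] using this
    have hcop : Nat.Coprime (p - 1) (p ^ j) := by
      refine Nat.Coprime.pow_right _ ?_
      have h := (Nat.coprime_self_sub_right hp.out.one_le).mpr (Nat.coprime_one_right p)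
      exact h.symm
    have := pow_gcd_eq_one.mpr ⟨h1, h2⟩
    rwa [hcop, pow_one] at this
  · intro h
    refine ⟨?_, ?_⟩
    · show χ (-1) = 1
      have := h (-1) (by
        rw [mem_teichmullerSubgroup]
        rcases neg_one_pow_eq_or (ZMod (p ^ m))ˣ (p - 1) with h' | h' <;> simp [h'])
      simpa using this
    · have hχn : χ ^ (p ^ m) = 1 := by
        ext a
        rw [MulChar.pow_apply_coe, MulChar.one_apply_coe, ← map_pow, ← Units.val_pow_eq_pow_val]
        exact h _ (pow_prime_pow_mem_teichmullerSubgroup hm a)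
      obtain ⟨j, -, hj⟩ := (Nat.dvd_prime_pow hp.out).mp (orderOf_dvd_of_pow_eq_one hχn)
      exact ⟨j, hj⟩

/-- **Primitivity mod `p^m`** (`m ≥ 1`): `χ` is primitive iff it is non-trivial on the kernel
`K` of reduction mod `p^{m-1}` (the only maximal proper divisor level). [folklore] -/
theorem isPrimitive_iff_exists_reductionKer {m : ℕ} (hm : m ≠ 0) (χ : DirichletCharacter ℂ (p ^ m)) :
    χ.IsPrimitive ↔ ∃ x ∈ reductionKer p m, χ (x : ZMod (p ^ m)) ≠ 1 := by
  haveI : NeZero (p ^ m) := ⟨pow_ne_zero _ hp.out.ne_zero⟩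
  have hdvd : p ^ (m - 1) ∣ p ^ m := pow_dvd_pow p (Nat.sub_le m 1)
  rw [← not_iff_not]
  push Not
  constructor
  · intro hprim x hx
    obtain ⟨j, hj, hjeq⟩ := (Nat.dvd_prime_pow hp.out).mp χ.conductor_dvd_level
    have hjlt : j < m :=
      lt_of_le_of_ne hj fun h ↦ hprim (by rw [DirichletCharacter.isPrimitive_def, hjeq, h])
    have hfac : χ.FactorsThrough (p ^ (m - 1)) :=
      (χ.mem_conductorSet_iff_conductor_dvd hdvd).mpr (hjeq ▸ pow_dvd_pow p (by omega))
    have hker := (DirichletCharacter.factorsThrough_iff_ker_unitsMap hdvd).mp hfac hx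
    rw [MonoidHom.mem_ker, Units.ext_iff] at hker
    simpa using hker
  · intro h hprim
    -- `χ` is trivial on `K`, hence factors through `p^(m-1)`, contradicting primitivity
    have hfac : χ.FactorsThrough (p ^ (m - 1)) := by
      rw [DirichletCharacter.factorsThrough_iff_ker_unitsMap hdvd]
      intro x hx
      rw [MonoidHom.mem_ker, Units.ext_iff]
      simpa using h x hx
    have hle : χ.conductor ≤ p ^ (m - 1) := Nat.sInf_le ((χ.mem_conductorSet_iff).mpr hfac)
    rw [DirichletCharacter.isPrimitive_def] at hprim
    rw [hprim] at hle
    have : p ^ (m - 1) < p ^ m := Nat.pow_lt_pow_right hp.out.one_lt (by omega)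
    omega

/-- Membership in `𝔛_m` in terms of `T` and `K` (`m ≥ 1`). [folklore] -/
theorem mem_wildChars_iff {m : ℕ} [NeZero (p ^ m)] (hm : m ≠ 0) (χ : DirichletCharacter ℂ (p ^ m)) :
    χ ∈ wildChars p m ↔ (∀ x ∈ teichmullerSubgroup p m, χ (x : ZMod (p ^ m)) = 1) ∧
      ∃ x ∈ reductionKer p m, χ (x : ZMod (p ^ m)) ≠ 1 := by
  rw [mem_wildChars, isPrimitive_iff_exists_reductionKer hm, ← even_and_ppow_iff_trivial_on_teichmuller hm]
  tauto

/-- `𝔛_m` is stable under multiplication by characters trivial on `H = T K`. [folklore] -/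
theorem mul_mem_wildChars {m : ℕ} [NeZero (p ^ m)] (hm : m ≠ 0) {χ₁ χ : DirichletCharacter ℂ (p ^ m)}
    (h₁ : ∀ x ∈ teichmullerMulReductionKer p m, χ₁ (x : ZMod (p ^ m)) = 1) (hχ : χ ∈ wildChars p m) :
    χ₁ * χ ∈ wildChars p m := by
  rw [mem_wildChars_iff hm] at hχ ⊢
  obtain ⟨hT, x, hxK, hx⟩ := hχ
  refine ⟨fun t ht ↦ ?_, ⟨x, hxK, ?_⟩⟩
  · rw [MulChar.mul_apply, hT t ht, h₁ t (Subgroup.mem_sup_left ht), one_mul]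
  · rw [MulChar.mul_apply, h₁ x (Subgroup.mem_sup_right hxK), one_mul]
    exact hx

/-- **Orthogonality for the family `𝔛_m`**: if `u ∈ (ℤ/p^mℤ)ˣ` does not lie in `H = T K`, then
`∑_{χ ∈ 𝔛_m} χ(u) = 0`. Proof: by duality for the finite abelian group `(ℤ/p^m)ˣ/H` (Mathlib
`CommGroup.exists_apply_ne_one_of_hasEnoughRootsOfUnity`) there is a character `χ₁` trivial on
`H` with `χ₁(u) ≠ 1`; multiplication by `χ₁` permutes `𝔛_m`, so the sum `S` satisfies
`S = χ₁(u) S`. [folklore] -/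
theorem sum_wildChars_apply_eq_zero {m : ℕ} [NeZero (p ^ m)] (hm : m ≠ 0) {u : (ZMod (p ^ m))ˣ}
    (hu : u ∉ teichmullerMulReductionKer p m) :
    ∑ χ ∈ wildChars p m, χ (u : ZMod (p ^ m)) = 0 := by
  classical
  set H := teichmullerMulReductionKer p m with hH
  -- duality on `G/H`
  have hmk : (QuotientGroup.mk u : (ZMod (p ^ m))ˣ ⧸ H) ≠ 1 := by
    rwa [Ne, QuotientGroup.eq_one_iff]
  haveI : NeZero (Monoid.exponent ((ZMod (p ^ m))ˣ ⧸ H)) :=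
    ⟨(Monoid.exponent_pos.mpr (Monoid.ExponentExists.of_finite (G := (ZMod (p ^ m))ˣ ⧸ H))).ne'⟩
  obtain ⟨φ, hφ⟩ :=
    CommGroup.exists_apply_ne_one_of_hasEnoughRootsOfUnity ((ZMod (p ^ m))ˣ ⧸ H) ℂ hmk
  let g : (ZMod (p ^ m))ˣ →* ℂˣ := φ.comp (QuotientGroup.mk' H)
  have hgH : ∀ x ∈ H, g x = 1 := fun x hx ↦ by
    simp only [g, MonoidHom.comp_apply, QuotientGroup.mk'_apply, (QuotientGroup.eq_one_iff x).mpr hx,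
      map_one]
  let χ₁ : DirichletCharacter ℂ (p ^ m) := MulChar.ofUnitHom g
  have hχ₁ : ∀ x : (ZMod (p ^ m))ˣ, χ₁ (x : ZMod (p ^ m)) = (g x : ℂ) := fun x ↦
    MulChar.ofUnitHom_coe g x
  have hχ₁H : ∀ x ∈ H, χ₁ (x : ZMod (p ^ m)) = 1 := fun x hx ↦ by
    rw [hχ₁, hgH x hx, Units.val_one]
  have hχ₁u : χ₁ (u : ZMod (p ^ m)) ≠ 1 := by
    rw [hχ₁]
    intro h
    exact hφ (Units.ext (by simpa [g] using h))
  -- multiplication by `χ₁` permutes `𝔛_m`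
  set S := ∑ χ ∈ wildChars p m, χ (u : ZMod (p ^ m)) with hS
  have hperm : S = χ₁ (u : ZMod (p ^ m)) * S := by
    rw [hS, Finset.mul_sum]
    refine (Finset.sum_nbij' (fun χ ↦ χ₁ * χ) (fun χ ↦ χ₁⁻¹ * χ) (fun χ hχ ↦ ?_) (fun χ hχ ↦ ?_)
      (fun χ _ ↦ by group) (fun χ _ ↦ by group) (fun χ _ ↦ ?_)).symm
    · exact mul_mem_wildChars hm hχ₁H (Finset.mem_coe.mp hχ)
    · refine mul_mem_wildChars hm (fun x hx ↦ ?_) (Finset.mem_coe.mp hχ)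
      rw [MulChar.inv_apply_eq_inv', hχ₁H x hx, inv_one]
    · rw [MulChar.mul_apply]
  have : (1 - χ₁ (u : ZMod (p ^ m))) * S = 0 := by linear_combination hperm
  exact (mul_eq_zero.mp this).resolve_left (sub_ne_zero.mpr hχ₁u.symm)

omit hp in
/-- A sum over `𝔛_m` of character values vanishes at non-units. [folklore] -/
theorem sum_wildChars_apply_eq_zero_of_not_isUnit {m : ℕ} [NeZero (p ^ m)] {x : ZMod (p ^ m)}
    (hx : ¬ IsUnit x) : ∑ χ ∈ wildChars p m, χ x = 0 :=
  Finset.sum_eq_zero fun χ _ ↦ MulChar.map_nonunit χ hx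

omit hp in
/-- `|∑_{χ ∈ 𝔛_m} χ(x)| ≤ #𝔛_m`. [folklore] -/
theorem norm_sum_wildChars_apply_le {m : ℕ} [NeZero (p ^ m)] (x : ZMod (p ^ m)) :
    ‖∑ χ ∈ wildChars p m, χ x‖ ≤ (wildChars p m).card := by
  refine (norm_sum_le _ _).trans ?_
  calc ∑ χ ∈ wildChars p m, ‖χ x‖ ≤ ∑ χ ∈ wildChars p m, (1 : ℝ) :=
        Finset.sum_le_sum fun χ _ ↦ χ.norm_le_one x
    _ = (wildChars p m).card := by simp

/-- **Support of the character sum over `𝔛_m` on the integers**: if `∑_{χ ∈ 𝔛_m} χ(n) ≠ 0` then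
`n^{2(p-1)} ≡ 1 (mod p^{m-1})`. [folklore] -/
theorem pow_eq_one_of_sum_wildChars_ne_zero {m : ℕ} [NeZero (p ^ m)] (hm : m ≠ 0) {n : ℕ}
    (hn : ∑ χ ∈ wildChars p m, χ (n : ZMod (p ^ m)) ≠ 0) :
    ((n : ℕ) : ZMod (p ^ (m - 1))) ^ (2 * (p - 1)) = 1 := by
  by_cases hu : IsUnit ((n : ℕ) : ZMod (p ^ m))
  · have hmem : hu.unit ∈ teichmullerMulReductionKer p m := by
      by_contra h
      exact hn (by simpa using sum_wildChars_apply_eq_zero hm h)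
    have := cast_pow_eq_one_of_mem_teichmullerMulReductionKer hmem
    rwa [IsUnit.unit_spec, map_natCast] at this
  · exact absurd (sum_wildChars_apply_eq_zero_of_not_isUnit hu) hn


omit hp in
/-- `𝔛_m` is stable under `χ ↦ χ⁻¹`. [folklore] -/
theorem inv_mem_wildChars {m : ℕ} [NeZero (p ^ m)] {χ : DirichletCharacter ℂ (p ^ m)}
    (hχ : χ ∈ wildChars p m) : χ⁻¹ ∈ wildChars p m := by
  rw [mem_wildChars] at hχ ⊢
  obtain ⟨h1, h2, j, hj⟩ := hχ
  refine ⟨by rwa [DirichletCharacter.isPrimitive_def, DirichletCharacter.conductor_inv], ?_, ⟨j, by rwa [orderOf_inv]⟩⟩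
  show χ⁻¹ (-1) = 1
  rw [MulChar.inv_apply_eq_inv', h2, inv_one]

omit hp in
/-- Reindexing a sum over `𝔛_m` by `χ ↦ χ⁻¹`. [folklore] -/
theorem sum_wildChars_inv {M : Type*} [AddCommMonoid M] {m : ℕ} [NeZero (p ^ m)]
    (F : DirichletCharacter ℂ (p ^ m) → M) :
    ∑ χ ∈ wildChars p m, F χ⁻¹ = ∑ χ ∈ wildChars p m, F χ :=
  Finset.sum_nbij' (fun χ ↦ χ⁻¹) (fun χ ↦ χ⁻¹) (fun _ hχ ↦ inv_mem_wildChars (Finset.mem_coe.mp hχ))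
    (fun _ hχ ↦ inv_mem_wildChars (Finset.mem_coe.mp hχ)) (fun χ _ ↦ inv_inv χ) (fun χ _ ↦ inv_inv χ)
    (fun _ _ ↦ rfl)

/-! ### Counting: solutions of `r^{2(p-1)} = 1` and the support of `∑_{χ ∈ 𝔛_m} χ` -/

/-- **Hensel-type rigidity**: for odd `p`, `l ≥ 1`, an element `w ∈ ℤ/p^lℤ` with
`w^{2(p-1)} = 1` and `w ≡ 1 (mod p)` equals `1` (its order divides `gcd(2(p-1), p^{l-1}) = 1`,
using `p^l ∣ a^{p^{l-1}} - 1` for `p ∣ a - 1`, Mathlib `dvd_sub_pow_of_dvd_sub`). [folklore] -/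
theorem eq_one_of_pow_eq_one_of_cast_eq_one (hp2 : p ≠ 2) {l : ℕ} (hl : l ≠ 0) {w : ZMod (p ^ l)}
    (hd : w ^ (2 * (p - 1)) = 1) (hw : ZMod.castHom (dvd_pow_self p hl) (ZMod p) w = 1) : w = 1 := by
  haveI : NeZero (p ^ l) := ⟨pow_ne_zero _ hp.out.ne_zero⟩
  -- `p ∣ a - 1` for the representative `a` of `w`
  have ha : ((p : ℕ) : ℤ) ∣ (w.val : ℤ) - 1 := by
    rw [← ZMod.intCast_zmod_eq_zero_iff_dvd]
    push_cast
    rw [ZMod.castHom_apply, ← ZMod.natCast_val] at hw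
    rw [hw, sub_self]
  -- hence `w^(p^(l-1)) = 1`
  have hpow : w ^ (p ^ (l - 1)) = 1 := by
    have h := dvd_sub_pow_of_dvd_sub ha (l - 1)
    rw [Nat.sub_add_cancel (Nat.pos_of_ne_zero hl), one_pow] at h
    have h' : (((w.val : ℤ) ^ (p ^ (l - 1)) - 1 : ℤ) : ZMod (p ^ l)) = 0 := by
      rw [ZMod.intCast_zmod_eq_zero_iff_dvd]; exact_mod_cast h
    push_cast at h'
    rw [ZMod.natCast_zmod_val] at h'
    exact sub_eq_zero.mp h'
  have hcop : Nat.Coprime (2 * (p - 1)) (p ^ (l - 1)) := by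
    refine Nat.Coprime.pow_right _ (Nat.Coprime.mul_left ?_ ?_)
    · exact (Nat.coprime_primes Nat.prime_two hp.out).mpr (Ne.symm hp2)
    · exact ((Nat.coprime_self_sub_right hp.out.one_le).mpr (Nat.coprime_one_right p)).symm
  have := pow_gcd_eq_one.mpr ⟨hd, hpow⟩
  rwa [hcop, pow_one] at this

/-- **At most `4p` solutions of `r^{2(p-1)} = 1` in `ℤ/p^lℤ`** (for odd `p` at most `p`, by
reduction mod `p` and `eq_one_of_pow_eq_one_of_cast_eq_one`; for `p = 2` the four square roots of
`1`). [folklore] -/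
theorem card_filter_pow_eq_one_le (l : ℕ) :
    (Finset.univ.filter fun r : ZMod (p ^ l) ↦ r ^ (2 * (p - 1)) = 1).card ≤ 4 * p := by
  classical
  have hp1 : 1 ≤ p := hp.out.one_le
  rcases Nat.eq_zero_or_pos l with rfl | hl
  · calc _ ≤ Fintype.card (ZMod (p ^ 0)) := Finset.card_le_univ _
      _ = 1 := by simp
      _ ≤ 4 * p := by omega
  by_cases hp2 : p = 2
  · subst hp2
    calc _ ≤ ({1, -1, 1 + ((2 ^ (l - 1) : ℕ) : ZMod (2 ^ l)), -1 + ((2 ^ (l - 1) : ℕ) : ZMod (2 ^ l))} :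
          Finset (ZMod (2 ^ l))).card := by
          refine Finset.card_le_card fun w hw ↦ ?_
          rw [Finset.mem_filter] at hw
          have hsq : w ^ 2 = 1 ^ 2 := by simpa using hw.2
          simp only [Finset.mem_insert, Finset.mem_singleton]
          rcases LFunctions.mem_of_sq_eq_sq_two hl.ne' isUnit_one hsq with h | h | h | h <;>
            simp only [h, true_or, or_true]
      _ ≤ 4 := Finset.card_le_four
      _ ≤ 4 * 2 := by norm_num
  · -- odd `p`: reduction mod `p` is injective on the solution set
    have hdvd : p ∣ p ^ l := dvd_pow_self p hl.ne'
    set red := ZMod.castHom hdvd (ZMod p) with hred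
    calc _ ≤ (Finset.univ : Finset (ZMod p)).card := by
          refine Finset.card_le_card_of_injOn red (fun r _ ↦ Finset.mem_coe.mpr (Finset.mem_univ _)) ?_
          intro r hr s hs hrs
          rw [Finset.mem_coe, Finset.mem_filter] at hr hs
          have hp2' := hp.out.two_le
          have hd0 : 2 * (p - 1) ≠ 0 := by omega
          have hsu : IsUnit s := IsUnit.of_pow_eq_one hs.2 hd0
          have hss : s⁻¹ * s = 1 := ZMod.inv_mul_of_unit s hsu
          have hw : (r * s⁻¹) ^ (2 * (p - 1)) = 1 := by
            have hsi : s⁻¹ ^ (2 * (p - 1)) = 1 := by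
              have h := congr_arg (· ^ (2 * (p - 1))) hss
              simp only [mul_pow, hs.2, mul_one, one_pow] at h
              exact h
            rw [mul_pow, hr.2, hsi, one_mul]
          have hreds : IsUnit (red s) := hsu.map red
          have hredw : red (r * s⁻¹) = 1 := by
            rw [map_mul]
            have hinv : red s⁻¹ = (red s)⁻¹ := by
              rw [hred, ZMod.castHom_apply, ZMod.castHom_apply]
              exact LFunctions.ZMod.cast_inv_of_isUnit hdvd hsu
            rw [hinv, hrs]
            exact ZMod.mul_inv_of_unit _ hreds
          have h1 := eq_one_of_pow_eq_one_of_cast_eq_one hp2 hl.ne' hw hredw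
          calc r = r * s⁻¹ * s := by rw [mul_assoc, hss, mul_one]
            _ = s := by rw [h1, one_mul]
      _ = p := by rw [Finset.card_univ, ZMod.card]
      _ ≤ 4 * p := by omega

/-- The support of `z ↦ ∑_{χ ∈ 𝔛_m} χ(z)` is contained in `{z : z^{2(p-1)} ≡ 1 (mod p^{m-1})}`.
[folklore] -/
theorem cast_pow_eq_one_of_sum_wildChars_ne_zero {m : ℕ} [NeZero (p ^ m)] (hm : m ≠ 0)
    {z : ZMod (p ^ m)} (hz : ∑ χ ∈ wildChars p m, χ z ≠ 0) :
    (ZMod.castHom (pow_dvd_pow p (Nat.sub_le m 1)) (ZMod (p ^ (m - 1))) z) ^ (2 * (p - 1)) = 1 := by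
  have h := pow_eq_one_of_sum_wildChars_ne_zero hm (n := z.val) (by rwa [ZMod.natCast_zmod_val])
  rwa [ZMod.castHom_apply, ← ZMod.natCast_val]

/-- **The support of `∑_{χ ∈ 𝔛_m} χ` has at most `4p²` elements.** [folklore] -/
theorem card_support_sum_wildChars_le {m : ℕ} [NeZero (p ^ m)] (hm : m ≠ 0) :
    (Finset.univ.filter fun z : ZMod (p ^ m) ↦ ∑ χ ∈ wildChars p m, χ z ≠ 0).card ≤ 4 * p * p := by
  classical
  set Q : ZMod (p ^ (m - 1)) → Prop := fun r ↦ r ^ (2 * (p - 1)) = 1 with hQ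
  calc _ ≤ (Finset.univ.filter fun z : ZMod (p ^ m) ↦
          Q (ZMod.castHom (pow_dvd_pow p (Nat.sub_le m 1)) (ZMod (p ^ (m - 1))) z)).card :=
        Finset.card_le_card fun z hz ↦ by
          rw [Finset.mem_filter] at hz ⊢
          exact ⟨hz.1, cast_pow_eq_one_of_sum_wildChars_ne_zero hm hz.2⟩
    _ = ((Finset.range (p ^ m)).filter fun u : ℕ ↦ Q (u : ZMod (p ^ (m - 1)))).card := by
        rw [Finset.card_filter, Finset.card_filter, LFunctions.sum_zmod_eq_sum_range]
        refine Finset.sum_congr rfl fun n _ ↦ ?_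
        rw [ZMod.castHom_apply, ZMod.cast_natCast (pow_dvd_pow p (Nat.sub_le m 1))]
    _ = p ^ (m - (m - 1)) * (Finset.univ.filter Q).card := LFunctions.card_filter_range_pow_eq (Nat.sub_le m 1) Q
    _ ≤ p ^ 1 * (4 * p) := by
        rw [show m - (m - 1) = 1 by omega]
        exact Nat.mul_le_mul_left _ (card_filter_pow_eq_one_le (m - 1))
    _ = 4 * p * p := by ring

/-! ### The Gauss-sum average over `𝔛_m` via Kloosterman sums -/

omit hp in
/-- For a unit `c` of `ZMod q`: `∑_b [a b = c] F(b)` is `F(c a⁻¹)` if `a` is a unit and `0`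
otherwise. [folklore] -/
theorem sum_ite_mul_eq {q : ℕ} [NeZero q] {c : ZMod q} (hc : IsUnit c) (F : ZMod q → ℂ)
    (a : ZMod q) :
    (∑ b : ZMod q, if a * b = c then F b else 0) = if IsUnit a then F (c * a⁻¹) else 0 := by
  classical
  by_cases ha : IsUnit a
  · rw [if_pos ha]
    have hiff : ∀ b : ZMod q, a * b = c ↔ b = c * a⁻¹ := by
      intro b
      have h1 : a * a⁻¹ = 1 := ZMod.mul_inv_of_unit a ha
      constructor
      · rintro rfl
        rw [mul_comm a b, mul_assoc, h1, mul_one]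
      · rintro rfl
        rw [mul_comm c, ← mul_assoc, h1, one_mul]
    simp_rw [hiff]
    rw [Finset.sum_ite_eq']
    simp
  · rw [if_neg ha]
    refine Finset.sum_eq_zero fun b _ ↦ ?_
    rw [if_neg]
    rintro rfl
    exact ha (isUnit_of_mul_isUnit_left hc)

omit hp in
/-- **The Gauss-sum average over `𝔛_m` is a short sum of Kloosterman sums.** For a unit `y`
mod `p^m`:
`∑_{χ ∈ 𝔛_m} χ(y) τ(χ)² = ∑_{h} A(h) · S(1, y⁻¹h; p^m)`, `A(h) = ∑_{χ ∈ 𝔛_m} χ(h)`,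
where `h` runs over the support of `A` (at most `4p²` classes, `card_support_sum_wildChars_le`).
[folklore] -/
theorem sum_wildChars_mul_gaussSum_sq_eq {m : ℕ} [NeZero (p ^ m)] {y : ZMod (p ^ m)} (hy : IsUnit y) :
    ∑ χ ∈ wildChars p m, χ y * gaussSum χ (ZMod.stdAddChar (N := p ^ m)) ^ 2 =
      ∑ h ∈ Finset.univ.filter (fun z : ZMod (p ^ m) ↦ ∑ χ ∈ wildChars p m, χ z ≠ 0),
        (∑ χ ∈ wildChars p m, χ h) * LFunctions.kloostermanSum (p ^ m) 1 (h * y⁻¹) := by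
  classical
  set A : ZMod (p ^ m) → ℂ := fun z ↦ ∑ χ ∈ wildChars p m, χ z with hA
  set e : ZMod (p ^ m) → ℂ := fun a ↦ (ZMod.stdAddChar a : ℂ) with he
  -- Step 1: expand the square and move the character sum inside
  have h1 : ∑ χ ∈ wildChars p m, χ y * gaussSum χ (ZMod.stdAddChar (N := p ^ m)) ^ 2 =
      ∑ a : ZMod (p ^ m), ∑ b : ZMod (p ^ m), e a * e b * A (y * a * b) := by
    have : ∀ χ ∈ wildChars p m, χ y * gaussSum χ (ZMod.stdAddChar (N := p ^ m)) ^ 2 =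
        ∑ a : ZMod (p ^ m), ∑ b : ZMod (p ^ m), e a * e b * χ (y * a * b) := by
      intro χ _
      rw [gaussSum, sq, Finset.sum_mul_sum, Finset.mul_sum]
      refine Finset.sum_congr rfl fun a _ ↦ ?_
      rw [Finset.mul_sum]
      refine Finset.sum_congr rfl fun b _ ↦ ?_
      rw [map_mul, map_mul, he]
      ring
    rw [Finset.sum_congr rfl this, Finset.sum_comm]
    refine Finset.sum_congr rfl fun a _ ↦ ?_
    rw [Finset.sum_comm]
    refine Finset.sum_congr rfl fun b _ ↦ ?_
    rw [hA, Finset.mul_sum]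
  -- Step 2: the support of `A`
  have h2 : ∀ z : ZMod (p ^ m), A z = ∑ h ∈ Finset.univ.filter (fun z : ZMod (p ^ m) ↦ A z ≠ 0),
      if z = h then A h else 0 := by
    intro z
    rw [Finset.sum_ite_eq]
    by_cases hz : A z = 0
    · rw [if_neg (by simp [hz]), hz]
    · rw [if_pos (by simp [hz])]
  have hyinv : y⁻¹ * y = 1 := ZMod.inv_mul_of_unit y hy
  have hyy : y * y⁻¹ = 1 := ZMod.mul_inv_of_unit y hy
  -- Step 3: for `h` in the support, `∑_{a b} [y a b = h] e(a) e(b) = S(1, h y⁻¹)`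
  have h3 : ∀ h : ZMod (p ^ m), A h ≠ 0 →
      ∑ a : ZMod (p ^ m), ∑ b : ZMod (p ^ m), (if y * a * b = h then e a * e b else 0) =
        LFunctions.kloostermanSum (p ^ m) 1 (h * y⁻¹) := by
    intro h hh
    have hhu : IsUnit h := by
      by_contra hnu
      exact hh (sum_wildChars_apply_eq_zero_of_not_isUnit hnu)
    have hyu : IsUnit y⁻¹ := by
      rw [← IsUnit.unit_spec hy, ZMod.inv_coe_unit]; exact Units.isUnit _
    have hcu : IsUnit (h * y⁻¹) := hhu.mul hyu
    rw [LFunctions.kloostermanSum]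
    refine Finset.sum_congr rfl fun a _ ↦ ?_
    have hiff : ∀ b : ZMod (p ^ m), (y * a * b = h) ↔ (a * b = h * y⁻¹) := by
      intro b
      constructor
      · intro hab; rw [← hab]; linear_combination (-(a * b)) * hyinv
      · intro hab
        calc y * a * b = y * (a * b) := by ring
          _ = h := by rw [hab]; linear_combination h * hyy
    simp_rw [hiff]
    rw [sum_ite_mul_eq hcu (fun b ↦ e a * e b) a]
    by_cases ha : IsUnit a
    · rw [if_pos ha, if_pos ha, he]
      dsimp only
      rw [← AddChar.map_add_eq_mul, one_mul]
    · rw [if_neg ha, if_neg ha]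
  -- assemble
  rw [h1]
  calc ∑ a : ZMod (p ^ m), ∑ b : ZMod (p ^ m), e a * e b * A (y * a * b)
      = ∑ a : ZMod (p ^ m), ∑ b : ZMod (p ^ m),
          ∑ h ∈ Finset.univ.filter (fun z : ZMod (p ^ m) ↦ A z ≠ 0),
            A h * (if y * a * b = h then e a * e b else 0) := by
        refine Finset.sum_congr rfl fun a _ ↦ Finset.sum_congr rfl fun b _ ↦ ?_
        rw [h2 (y * a * b), Finset.mul_sum]
        refine Finset.sum_congr rfl fun h _ ↦ ?_
        split_ifs <;> ring
    _ = ∑ a : ZMod (p ^ m), ∑ h ∈ Finset.univ.filter (fun z : ZMod (p ^ m) ↦ A z ≠ 0),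
          ∑ b : ZMod (p ^ m), A h * (if y * a * b = h then e a * e b else 0) :=
        Finset.sum_congr rfl fun a _ ↦ Finset.sum_comm
    _ = ∑ h ∈ Finset.univ.filter (fun z : ZMod (p ^ m) ↦ A z ≠ 0), ∑ a : ZMod (p ^ m),
          ∑ b : ZMod (p ^ m), A h * (if y * a * b = h then e a * e b else 0) := Finset.sum_comm
    _ = ∑ h ∈ Finset.univ.filter (fun z : ZMod (p ^ m) ↦ A z ≠ 0),
          A h * ∑ a : ZMod (p ^ m), ∑ b : ZMod (p ^ m), (if y * a * b = h then e a * e b else 0) := by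
        refine Finset.sum_congr rfl fun h _ ↦ ?_
        rw [Finset.mul_sum]
        exact Finset.sum_congr rfl fun a _ ↦ by rw [Finset.mul_sum]
    _ = _ := by
        refine Finset.sum_congr rfl fun h hh ↦ ?_
        rw [h3 h (Finset.mem_filter.mp hh).2]


/-- **The Gauss-sum average bound.** For a unit `y` mod `p^m`, `m ≥ 1`:
`‖∑_{χ ∈ 𝔛_m} χ(y) τ(χ)²‖ ≤ 4p² · #𝔛_m · 4 p^{⌈m/2⌉}` — the square-root cancellation in the
family average of the root numbers `τ(χ)²/p^m` of the twists (Rohrlich 1984, §3–4, there via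
explicit Gauss sums; here via `norm_kloostermanSum_one_le`). [folklore] -/
theorem norm_sum_wildChars_mul_gaussSum_sq_le {m : ℕ} [NeZero (p ^ m)] (hm : m ≠ 0)
    {y : ZMod (p ^ m)} (hy : IsUnit y) :
    ‖∑ χ ∈ wildChars p m, χ y * gaussSum χ (ZMod.stdAddChar (N := p ^ m)) ^ 2‖ ≤
      (4 * p * p : ℕ) * ((wildChars p m).card * (4 * (p : ℝ) ^ (m - m / 2))) := by
  classical
  rw [sum_wildChars_mul_gaussSum_sq_eq hy]
  refine (norm_sum_le _ _).trans ?_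
  calc ∑ h ∈ Finset.univ.filter (fun z : ZMod (p ^ m) ↦ ∑ χ ∈ wildChars p m, χ z ≠ 0),
        ‖(∑ χ ∈ wildChars p m, χ h) * LFunctions.kloostermanSum (p ^ m) 1 (h * y⁻¹)‖
      ≤ ∑ h ∈ Finset.univ.filter (fun z : ZMod (p ^ m) ↦ ∑ χ ∈ wildChars p m, χ z ≠ 0),
          (wildChars p m).card * (4 * (p : ℝ) ^ (m - m / 2)) := by
        refine Finset.sum_le_sum fun h _ ↦ ?_
        rw [norm_mul]
        exact mul_le_mul (norm_sum_wildChars_apply_le h) (LFunctions.norm_kloostermanSum_one_le m _)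
          (norm_nonneg _) (Nat.cast_nonneg _)
    _ ≤ _ := by
        rw [Finset.sum_const, nsmul_eq_mul]
        gcongr
        exact_mod_cast card_support_sum_wildChars_le hm

end Literature.NumberTheory.EllipticCurves
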